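import Summits.BirchSwinnertonDyer.BirchSwinnertonDyer.Theorems.GenusKolyvaginAtTwoGenusPrimitiveSupplyAtTwoArchimedeanCapstone
import Summits.BirchSwinnertonDyer.BirchSwinnertonDyer.Theorems.GenusKolyvaginAtTwoGenusPrimitiveSupplyAtTwoPrimeHeegnerTwinPosDisc
import Literature.NumberTheory.EllipticCurves.MatsunoTwistedCurvesLocalProofs
import Literature.NumberTheory.EllipticCurves.TwoDescentLocalExhibits
import Literature.NumberTheory.EllipticCurves.SerreOpenImageOrdinaryInertiaProofs
import Literature.NumberTheory.EllipticCurves.LocalEulerCharacteristicTorsion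
import HarnessLib

/-!
# Route `GenusKolyvaginAtTwo`, crux #2 `GenusPrimitiveSupplyAtTwo` (stmt-BirchSwinnertonDyer-22136):
# the cell's T-A `F1Sign2.AdmissibleTwistSelmerShiftAtTwo` ON THE HABITAT (`ρ̄_{W,2}` onto), in its own currency
# `DescAdmissible`, modulo {PT, Tate χ, Kramer parity} ONLY

Width seat `bsd-line-gk2-p5` g9 (cell `bsd-f1-sign2`, SUPPLY lineage, «UP general-K lane»), file 25 of the series (sequel of
`…ArchimedeanCapstone.lean` p637213). THEOREMS ONLY (no definition, no named fact, no `sorry`, no local instance); helper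
`--supports stmt-BirchSwinnertonDyer-22136`; no item is closed; BSD is not proved by any of this.

WHAT. The cell's Δ > 0 supply rows (g7 `supply_DEF1_posDisc_of_shift_habitat`, g9 `supply_DEF1_minimalTwin_habitat_of_parity`) take
T-A `AdmissibleTwistSelmerShiftAtTwo` BY NAME. T-A as typed (hypothesis `NoRationalTwoTorsion`) is out of reach of Kramer's congruence as
typed (`kramerParity`'s `huniq` fails for image-`C₃` curves), but ON THE HABITAT (`ρ̄_{W,2}` onto ⟹ `E(ℚ)[2] = 0`) it is now a kernel
theorem modulo the three published facts {PT, Tate χ, Kramer parity}: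

* §61 `natCard_ker_nsmul_eq_of_intertwining` — `#Wd(F)[n] = #W(F)[n]` at every `K`-field `F` for a pair of inverse intertwinings
  `Wd[n] ≅ W[n]` (`H⁰` is functorial; tree `natCard_invariants_torsion_restrictField`) — the «silent twist» lemma: a prime silent for
  `W` is silent for every model of `W^{(d)}`;
* §62 `descAdmissible_place_menu` — for `d` descent-admissible (`F1Sign2.DescAdmissible W d`: `d < 0` squarefree, `d ≡ 1 (8)`, primes of `d`
  good with `a_q` odd, `(d/ℓ) = 1` at odd bad `ℓ`) EVERY finite place of `ℚ` is on the menu of file 21/24: `2` and the odd bad primes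
  are split in `ℚ(√d)` (Serre II.3.3: `d ≡ 1 (8)` ⟹ `d ∈ ℚ₂^{×2}`; `(d/ℓ) = 1` ⟹ `d ∈ ℚ_ℓ^{×2}`), the primes of `d` are odd and SILENT
  for `W` (`a_q` odd ⟺ no `2`-torsion mod `q`, g7 `silent_iff_odd_frobeniusTrace`, g6 `twoTorsion_padic_eq_zero_of_forall_ne`) and for
  `Wd` (§61), the remaining primes are odd and good for both;
* §63 `admissibleTwistSelmerShift_habitat_of_parity` — **for `W/ℚ` globally minimal with `ρ̄_{W,2}` onto and `Δ_W > 0`, and every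
  descent-admissible `d`: `2·#Sel₂(W^{(d)}) = #Sel₂(W) ∨ #Sel₂(W^{(d)}) = 2·#Sel₂(W)`** (the conclusion of T-A verbatim, in the cell's
  `twistSelmerTwoCard` / `selmerTwoCard` currency), CONDITIONAL on `hPT`, `hEP`, `hKP : MazurRubin2010.kramerParity ℚ` only — by
  file 24's `natCard_selmerGroup_twist_shift_of_places_inl` at the real place of `ℚ`.

References: [MazurRubin2010] Thm. 2.7, Lemmas 2.9–2.10, Prop. 3.3, Cor. 3.4 (i); [Kramer1981] §2 Prop. 3, Prop. 6, Thm. 1; [Serre1973]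
II.3.3 Thm. 3–4; [SilvermanAEC2009] VII.5.1, X.1.4; [MilneADT2006] I Thm. 2.8, 2.13, 4.10.
-/

set_option linter.dupNamespace false -- tree convention: `Summit.BirchSwinnertonDyer.BirchSwinnertonDyer.Theorems` (summit = sub-problem)
set_option autoImplicit false

noncomputable section

open scoped Classical ContRepresentation

namespace Summit.BirchSwinnertonDyer.BirchSwinnertonDyer.Theorems.GenusKolyArch

open WeierstrassCurve Field NumberField IsDedekindDomain Function
open Literature.NumberTheory.EllipticCurves Literature.NumberTheory.GaloisRepresentations
open Literature.NumberTheory.GaloisCohomology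
open Summit.BirchSwinnertonDyer.BirchSwinnertonDyer.Theorems.GenusKolyTwistLocal
open Summit.BirchSwinnertonDyer.Rank1Residual.F1Sign2
open Rat.HeightOneSpectrum (primesEquiv natGenerator)

universe u

/-! ## §61 The silent-twist lemma: `#Wd(F)[n] = #W(F)[n]` along an intertwining `Wd[n] ≅ W[n]` -/

section Silent

variable {K : Type u} [Field K] [NumberField K] (W Wd : WeierstrassCurve K) [W.IsElliptic] [Wd.IsElliptic]

/-- **`#Wd(F)[n] = #W(F)[n]` for congruent curves.** If `Wd[n] ≅ W[n]` as `Γ_K`-modules (a pair of inverse intertwinings), then at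
every `K`-field `F` of characteristic `0` the groups of `F`-rational `n`-torsion points have the same order: both are `H⁰(Γ_F, ·)` of the
restricted modules (tree `natCard_invariants_torsion_restrictField`), and `H⁰` is functorial. For a twist pair this is «`E^{(d)}(K_v)[2] ≅
E(K_v)[2]`» (the `2`-torsion abscissae are the same). [cite: MazurRubin2010, Lemma 2.2 (i)–(ii)] [cite: MilneADT2006, I §3, Lemma 3.3] -/
theorem natCard_ker_nsmul_eq_of_intertwining (n : ℕ) (hn : n ≠ 0)
    (φ : (Wd.torsionGaloisModule (n : ℤ)).toContRepresentation →ⁱL (W.torsionGaloisModule (n : ℤ)).toContRepresentation)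
    (ψ : (W.torsionGaloisModule (n : ℤ)).toContRepresentation →ⁱL (Wd.torsionGaloisModule (n : ℤ)).toContRepresentation)
    (hψφ : ∀ a, ψ (φ a) = a) (hφψ : ∀ b, φ (ψ b) = b)
    (F : Type u) [Field F] [Algebra K F] [CharZero F] :
    Nat.card (nsmulAddMonoidHom n : (Wd.baseChange F).toAffine.Point →+ _).ker =
      Nat.card (nsmulAddMonoidHom n : (W.baseChange F).toAffine.Point →+ _).ker := by
  rw [← natCard_invariants_torsion_restrictField Wd F hn, ← natCard_invariants_torsion_restrictField W F hn]
  have h1 : ∀ (g : absoluteGaloisGroup F) (v : geomTorsion Wd (n : ℤ)),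
      (φ.restrictField F) ((GaloisRep.restrictField F (Wd.torsionGaloisModule (n : ℤ))).toContRepresentation g v) =
        (GaloisRep.restrictField F (W.torsionGaloisModule (n : ℤ))).toContRepresentation g ((φ.restrictField F) v) :=
    fun g v ↦ congrArg (fun f : _ →L[ℤ] _ ↦ f v) ((φ.restrictField F).isIntertwining' g)
  have h2 : ∀ (g : absoluteGaloisGroup F) (v : geomTorsion W (n : ℤ)),
      (ψ.restrictField F) ((GaloisRep.restrictField F (W.torsionGaloisModule (n : ℤ))).toContRepresentation g v) =
        (GaloisRep.restrictField F (Wd.torsionGaloisModule (n : ℤ))).toContRepresentation g ((ψ.restrictField F) v) :=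
    fun g v ↦ congrArg (fun f : _ →L[ℤ] _ ↦ f v) ((ψ.restrictField F).isIntertwining' g)
  refine Nat.card_congr
    { toFun := fun v ↦ ⟨φ v.1, fun g ↦ ?_⟩
      invFun := fun v ↦ ⟨ψ v.1, fun g ↦ ?_⟩
      left_inv := fun v ↦ Subtype.ext (hψφ v.1)
      right_inv := fun v ↦ Subtype.ext (hφψ v.1) }
  · have hv := v.2 g
    have := h1 g v.1
    simp only [ContIntertwiningMap.restrictField_apply] at this
    change (GaloisRep.restrictField F (W.torsionGaloisModule (n : ℤ))).toContRepresentation g (φ v.1) = φ v.1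
    rw [← this]
    exact congrArg φ hv
  · have hv := v.2 g
    have := h2 g v.1
    simp only [ContIntertwiningMap.restrictField_apply] at this
    change (GaloisRep.restrictField F (Wd.torsionGaloisModule (n : ℤ))).toContRepresentation g (ψ v.1) = ψ v.1
    rw [← this]
    exact congrArg ψ hv

end Silent

/-! ## §62 A descent-admissible `d` puts every finite place of `ℚ` on the menu -/

section Menu

variable (W : WeierstrassCurve ℚ) [W.IsElliptic] [W.IsGloballyMinimal]

/-- **The finite place menu for a descent-admissible twist parameter.** `W/ℚ` globally minimal elliptic, `d` with `F1Sign2.DescAdmissible W d`,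
`Wd = C • W^{(d)}`, `φ, ψ` inverse intertwinings `Wd[2] ≅ W[2]`: every finite place `v` of `ℚ` is split in `ℚ(√d)` (over `2`: `d ≡ 1 (8)`;
over an odd bad prime: `(d/ℓ) = 1`), or odd and silent for both curves (over the primes of `d`: `a_q` odd), or odd and good for both.
[cite: Serre1973, Ch. II §3.3 Thm 3] [cite: Serre1973, Ch. II §3.3 Thm 4] [cite: Kramer1981, Prop. 3] [cite: MazurRubin2010, Lemma 2.10] -/
theorem descAdmissible_place_menu {d : ℤ} (hd : DescAdmissible W d) {Wd : WeierstrassCurve ℚ} [Wd.IsElliptic]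
    {C : VariableChange ℚ} (hC : C • W.quadraticTwist (d : ℚ) = Wd)
    (φ : (Wd.torsionGaloisModule ((2 : ℕ) : ℤ)).toContRepresentation →ⁱL
      (W.torsionGaloisModule ((2 : ℕ) : ℤ)).toContRepresentation)
    (ψ : (W.torsionGaloisModule ((2 : ℕ) : ℤ)).toContRepresentation →ⁱL
      (Wd.torsionGaloisModule ((2 : ℕ) : ℤ)).toContRepresentation)
    (hψφ : ∀ a, ψ (φ a) = a) (hφψ : ∀ b, φ (ψ b) = b) :
    ∀ v : HeightOneSpectrum (𝓞 ℚ),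
      (∃ s : v.adicCompletion ℚ, s ^ 2 = algebraMap ℚ (v.adicCompletion ℚ) (d : ℚ)) ∨
      (((2 : ℕ) : 𝓞 ℚ) ∉ v.asIdeal ∧ W.HasGoodReductionAt v ∧ Wd.HasGoodReductionAt v) ∨
      (((2 : ℕ) : 𝓞 ℚ) ∉ v.asIdeal ∧
        Nat.card (nsmulAddMonoidHom 2 : (W.baseChange (v.adicCompletion ℚ)).toAffine.Point →+ _).ker = 1 ∧
        Nat.card (nsmulAddMonoidHom 2 : (Wd.baseChange (v.adicCompletion ℚ)).toAffine.Point →+ _).ker = 1) := by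
  obtain ⟨-, -, hd8, hprimes, hbad⟩ := hd
  intro v
  haveI := Fact.mk (primesEquiv v).2
  have hpP : (primesEquiv v : ℕ).Prime := (primesEquiv v).2
  have hpv : ((primesEquiv v : ℕ) : 𝓞 ℚ) ∈ v.asIdeal := Rat.HeightOneSpectrum.natCast_natGenerator_mem v
  -- a `p`-adic square gives the split option
  have hsplit : IsSquare ((d : ℤ) : ℚ_[(primesEquiv v : ℕ)]) →
      ∃ s : v.adicCompletion ℚ, s ^ 2 = algebraMap ℚ (v.adicCompletion ℚ) (d : ℚ) := fun hsq ↦ by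
    have hsq' : IsSquare (((d : ℚ) : ℚ) : ℚ_[(primesEquiv v : ℕ)]) := by
      simpa only [Rat.cast_intCast] using hsq
    obtain ⟨s, hs⟩ := TwoDescentLocal.isSquare_algebraMap_adicCompletion_of_padic v hsq'
    exact ⟨s, by rw [sq]; exact hs.symm⟩
  by_cases hp2 : (primesEquiv v : ℕ) = 2
  · -- over `2`: `d ≡ 1 (mod 8)` is a `2`-adic square
    exact Or.inl (hsplit (Literature.NumberTheory.QuadraticForms.padic_isSquare_intCast_of_mod_eight hp2 hd8))
  have h2v : ((2 : ℕ) : 𝓞 ℚ) ∉ v.asIdeal :=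
    GenusKolyTwistingPrime.natCast_not_mem_of_not_dvd hpP hpv fun h ↦
      hp2 ((Nat.prime_dvd_prime_iff_eq hpP Nat.prime_two).mp h)
  by_cases hpd : ((primesEquiv v : ℕ) : ℤ) ∣ d
  · -- over a prime of `d`: odd, good, `a_p` odd ⟹ silent for `W`, hence for `Wd`
    obtain ⟨hgood, hodd⟩ := hprimes _ hpP hpd
    have hgood' : W.HasGoodReductionAtPrime (primesEquiv v : ℕ) := hgood inferInstance
    have hpΔ : ¬ ((primesEquiv v : ℕ) : ℤ) ∣ minimalDiscriminantInt W :=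
      W.not_dvd_minimalDiscriminantInt_of_hasGoodReductionAtPrime' _ hgood'
    have hsil := (GenusKolyTwin.silent_iff_odd_frobeniusTrace W hp2 hpΔ).mpr hodd
    have hker : Nat.card (nsmulAddMonoidHom 2 : (W.baseChange (v.adicCompletion ℚ)).toAffine.Point →+ _).ker = 1 := by
      rw [natCard_ker_nsmul_adicCompletion_eq_padic W v 2]
      have h0 := GenusKolyTwin.twoTorsion_padic_eq_zero_of_forall_ne W hp2 hpΔ hsil
      rw [Nat.card_eq_one_iff_unique]
      refine ⟨⟨fun a b ↦ Subtype.ext ((h0 a.1 a.2).trans (h0 b.1 b.2).symm)⟩, ⟨⟨0, by simp⟩⟩⟩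
    refine Or.inr (Or.inr ⟨h2v, hker, ?_⟩)
    -- the `CharZero` / `Algebra` instances are passed explicitly so that the `ℚ`-algebra structure of `ℚ_v` stays the
    -- `adicCompletion` one (not `DivisionRing.toRatAlgebra`)
    rw [@natCard_ker_nsmul_eq_of_intertwining ℚ _ _ W Wd _ _ 2 two_ne_zero φ ψ hψφ hφψ (v.adicCompletion ℚ) _
      (HeightOneSpectrum.instAlgebraAdicCompletion (𝓞 ℚ) ℚ v) (charZero_adicCompletion v)]
    exact hker
  by_cases hpN : (primesEquiv v : ℕ) ∣ W.conductorNorm ℤ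
  · -- over an odd bad prime: `(d/p) = 1` makes `d` a `p`-adic square
    have hnotgood : ∀ _h : Fact (primesEquiv v : ℕ).Prime, ¬ W.HasGoodReductionAtPrime (primesEquiv v : ℕ) := fun _ hg ↦
      not_dvd_conductorNorm_of_hasGoodReductionAtPrime W hg hpN
    have hJ := hbad _ hpP hp2 hnotgood
    exact Or.inl (hsplit (padic_isSquare_of_jacobiSym_eq_one hp2 hJ))
  · -- over an odd good prime not dividing `d`: good for both
    have hW : W.HasGoodReductionAt v := by
      by_contra h
      exact hpN ((W.dvd_conductorNorm_iff v).mpr h)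
    have hp2d : ¬ (((primesEquiv v : Nat.Primes) : ℕ) : ℤ) ∣ 2 * d := by
      intro h
      rcases (Nat.prime_iff_prime_int.mp hpP).dvd_or_dvd h with h2' | hd'
      · exact hp2 ((Nat.prime_dvd_prime_iff_eq hpP Nat.prime_two).mp (by exact_mod_cast h2'))
      · exact hpd hd'
    exact Or.inr (Or.inl ⟨h2v, hW, hasGoodReductionAt_of_smul_quadraticTwist W v hp2d hW hC⟩)

end Menu

/-! ## §63 T-A on the habitat, modulo {PT, Tate χ, Kramer parity} -/

section TA

/-- **The cell's T-A `F1Sign2.AdmissibleTwistSelmerShiftAtTwo` ON THE HABITAT — kernel theorem modulo Poitou–Tate duality (Milne I 4.10),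
Tate's local Euler characteristic (Milne I 2.8) and Kramer's congruence `MazurRubin2010.kramerParity ℚ` (Mazur–Rubin Thm. 2.7) BY NAME,
nothing else.** For `W/ℚ` globally minimal elliptic with `ρ̄_{W,2}` onto (the habitat of crux 22136; it replaces T-A's `NoRationalTwoTorsion`)
and `Δ_W > 0`, and every descent-admissible `d`: `2·#Sel₂(W^{(d)}) = #Sel₂(W)` or `#Sel₂(W^{(d)}) = 2·#Sel₂(W)` — Mazur–Rubin's
Cor. 3.4 (i) for the twist pair `(W, W^{(d)})` whose only `T`-place is the real place (all finite places on the menu, §62; `#𝓛_∞ = 2`;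
transversality at `∞`, file 23), DOWN or UP according as `Sel₂(W)` has a class non-trivial at `∞` or is strict at `∞` (the descent sign).
[cite: MazurRubin2010, Thm. 2.7, Lemma 2.9, Prop. 3.3, Cor. 3.4 (i)] [cite: Kramer1981, §2 Prop. 6, Thm. 1] [cite: MilneADT2006, I Thm. 2.13, 4.10] -/
theorem admissibleTwistSelmerShift_habitat_of_parity
    (hPT : poitouTate_selmerStructure_duality_real ℚ)
    (hEP : ∀ v : HeightOneSpectrum (𝓞 ℚ), localEulerPoincareCharacteristic (v.adicCompletion ℚ))
    (hKP : MazurRubin2010.kramerParity ℚ)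
    (W : WeierstrassCurve ℚ) [W.IsElliptic] [W.IsGloballyMinimal] (hsurj : W.HasSurjectiveModNGaloisRep 2) (hΔ : 0 < W.Δ)
    (d : ℤ) (hd : DescAdmissible W d) :
    2 * twistSelmerTwoCard W d = selmerTwoCard W ∨ twistSelmerTwoCard W d = 2 * selmerTwoCard W := by
  have hdneg : d < 0 := hd.1
  have hd0 : d ≠ 0 := hdneg.ne
  have hd0' : ((d : ℤ) : ℚ) ≠ 0 := by exact_mod_cast hd0
  haveI := W.isElliptic_quadraticTwist hd0'
  set Wd : WeierstrassCurve ℚ := W.quadraticTwist ((d : ℤ) : ℚ) with hWd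
  have hC : (1 : VariableChange ℚ) • W.quadraticTwist ((d : ℤ) : ℚ) = Wd := one_smul _ _
  obtain ⟨φ, ψ, hψφ, hφψ, -⟩ := exists_intertwining_hsplit W hd0' hC
  have hdsq : ∀ x : ℚ, x ^ 2 ≠ ((d : ℤ) : ℚ) := fun x hx ↦ by
    have h0 : (0 : ℚ) ≤ (d : ℚ) := by rw [← hx]; exact sq_nonneg x
    exact absurd (by exact_mod_cast h0 : (0 : ℤ) ≤ d) (not_le.mpr hdneg)
  have hdneg' : ((d : ℤ) : ℚ) < 0 := by exact_mod_cast hdneg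
  set w₀ : InfinitePlace ℚ := Rat.infinitePlace
  have hw₀ : w₀.IsReal := Rat.isReal_infinitePlace
  have hΔ' : 0 < InfinitePlace.embedding_of_isReal hw₀ W.Δ := by rwa [embedding_of_isReal_rat_apply, Rat.cast_pos]
  have hinf : ∀ w : InfinitePlace ℚ, w ≠ w₀ →
      (∃ s : w.Completion, s ^ 2 = algebraMap ℚ w.Completion ((d : ℤ) : ℚ)) ∨
      ((∀ x : galoisCohomology (W.localGaloisModule w.Completion) 1, x = 0) ∧
        (∀ x : galoisCohomology (Wd.localGaloisModule w.Completion) 1, x = 0)) :=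
    fun w hw ↦ absurd (Subsingleton.elim w w₀) hw
  have h := natCard_selmerGroup_twist_shift_of_places_inl W hPT hEP hKP hsurj hdsq hC hw₀ hΔ'
    (forall_sq_ne_completion_of_neg hdneg' w₀) (descAdmissible_place_menu W hd hC φ ψ hψφ hφψ) hinf
  have hmodel : Nat.card (Wd.selmerGroup 2) = twistSelmerTwoCard W d :=
    GenusKolyTwin.natCard_selmerGroup_model_eq_twistSelmerTwoCard W hd0 Wd ⟨1, hC⟩
  change Nat.card (Wd.selmerGroup 2) * 2 = Nat.card (W.selmerGroup 2) ∨
    Nat.card (Wd.selmerGroup 2) = Nat.card (W.selmerGroup 2) * 2 at h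
  rw [hmodel] at h
  change twistSelmerTwoCard W d * 2 = selmerTwoCard W ∨ twistSelmerTwoCard W d = selmerTwoCard W * 2 at h
  omega

end TA

end Summit.BirchSwinnertonDyer.BirchSwinnertonDyer.Theorems.GenusKolyArch

end
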